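import Mathlib
import Literature.Computability.AlgebraicComplexity.XyzCubeFlattening
import Literature.Computability.AlgebraicComplexity.BorderRankRestriction
import Literature.Computability.AlgebraicComplexity.GroupAlgebraTensor
import Summits.MatrixMultiplication.MatrixMultiplication.Theorems.SoloInformedAsymptoticRankPower
import Summits.MatrixMultiplication.MatrixMultiplication.Theorems.SoloInformedCwTwoDoor

/-!
# Door D6 in the kernel: weighted digit designs give `bR(T_{cw,2}^{⊠N}) ≤ |B|`, hence `ω`-bounds

Solo-informed seat, door D6 (group / TPP-type realizations of Kronecker powers of `T_{cw,2}`).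
`SoloInformedCwTwoGroupRigidity` proved that every group realization of the support
`S_N = supp(X^{⊠N})` (`X` = the `xyz` tensor, `≅ T_{cw,2}` over `ℂ`) is DIGITAL with commuting digits,
i.e. a digit design in an abelian group `B`: digits `f k : Fin 3 → B`, word sums
`P(u) = ∑ₖ f k (u k)`, and `P(u) + P(v) + P(w) = σ := ∑ₖ (f k 0 + f k 1 + f k 2)` on `S_N`. This
file proves the converse half of the door, as used by Alman–Vassilevska Williams for `N = 1`
(`CW_q` is a monomial degeneration of `T_{ℤ/(q+2)}`): a WEIGHTED digit design — natural digit
weights `a k : Fin 3 → ℕ` such that every solution of `P(u)+P(v)+P(w) = σ` off `S_N` has total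
weight `> h₀ := ∑ₖ (a k 0 + a k 1 + a k 2)` (the common weight of the `S_N`-triples) — yields an
order-`h₀` approximate decomposition of `X^{⊠N}` with `|B̂| = |B|` triads
(`u_ψ(u) = ψ(P u) ε^{wt u}`, `v_ψ(v) = ψ(P v) ε^{wt v}`, `w_ψ(w) = ψ(P w − σ) ε^{wt w}/|B|`;
character orthogonality `∑_ψ ψ(x) = |B|[x = 0]`), so

* `tensorRank_kroneckerPow_xyzTensor_le_card` / `…_cwTensor_two_le_card`: an EXACT design
  (`P u + P v + P w = σ` only on `S_N`) gives the RANK bound `R(T_{cw,2}^{⊠N}) ≤ R(X^{⊠N}) ≤ |B|`,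
* `approxRank_kroneckerPow_xyzTensor_le_card`: `R_{h₀}(X^{⊠N}) ≤ |B|`,
* `algBorderRank_kroneckerPow_cwTensor_two_le_card`: `bR(T_{cw,2}^{⊠N}) ≤ |B|`
  (via `X ≥ T_{cw,2}`, `tensorRestrictsTo_xyzTensor_cwTensor`, the inverse of the tree's basis change),
* `asymptoticRank_cwTensor_two_le_of_design`: `R̃(T_{cw,2}) ≤ |B|^{1/N}`,
* `matrixMultiplication_of_weighted_designs` (THE DOOR): weighted designs of `S_N` in abelian
  groups of order `≤ (3+ε)^N` for every `ε > 0` imply `ω(ℂ) = 2`.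

References: J. Alman, V. Vassilevska Williams, *Limits on all known (and some unknown) approaches
to matrix multiplication*, FOCS 2018, arXiv:1810.08671, Thm 7.2 and §6 (monomial degenerations of
group tensors); M. Bläser, *Fast Matrix Multiplication*, ToC Grad. Surveys 5 (2013), Def. 6.1
(`R_h`, border rank); Conner–Gesmundo–Landsberg–Ventura 2022, §2.2 (`T_{cw,2} ≅ xyz`).
-/

noncomputable section

open scoped BigOperators
open Polynomial

namespace Summit.MatrixMultiplication.MatrixMultiplication.Theorems

open Literature.Computability.AlgebraicComplexity

/-! ## `X ≥ T_{cw,2}` over `ℂ` (inverse change of basis) -/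

section XyzToCw

/-- A triple sum against `X` is the sum over its six entries (the permutations of `(0,1,2)`).
[cite: ConnerGesmundoLandsbergVentura2022, §2.2] -/
theorem sum_mul_xyzTensor {R : Type*} [CommSemiring R] (g : Fin 3 → Fin 3 → Fin 3 → R) :
    ∑ a, ∑ b, ∑ c, g a b c * xyzTensor R a b c =
      g 0 1 2 + g 0 2 1 + g 1 0 2 + g 1 2 0 + g 2 0 1 + g 2 1 0 := by
  simp only [Fin.sum_univ_three, xyzTensor_apply, comp1]
  simp
  ring

/-- The inverse `xyzToCw = cwToXyz⁻¹` of the tree's basis change: rows `(1,0,0)`, `(0,½,1)`,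
`(0,−i/2,i)`. [cite: ConnerGesmundoLandsbergVentura2022, §2.2 (proof of Lemma 2.4)] -/
def xyzToCw : Fin 3 → Fin 3 → ℂ :=
  ![![1, 0, 0], ![0, ((1 : ℝ) / 2 : ℝ), 1], ![0, -(((1 : ℝ) / 2 : ℝ) * Complex.I), Complex.I]]

/-- **`X ≥ T_{cw,2}` over `ℂ`**: `(T_{cw,2})_{a'b'c'} = ∑ Q_{a'a} Q_{b'b} Q_{c'c} X_{abc}` for
`Q = xyzToCw`; with the tree's `tensorRestrictsTo_cwTensor_xyzTensor` the two tensors are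
restriction-equivalent. [cite: ConnerGesmundoLandsbergVentura2022, §2.2 (proof of Lemma 2.4)] -/
theorem tensorRestrictsTo_xyzTensor_cwTensor : TensorRestrictsTo (xyzTensor ℂ) (cwTensor ℂ 2) := by
  refine ⟨xyzToCw, xyzToCw, xyzToCw, fun a b c => ?_⟩
  rw [sum_mul_xyzTensor (R := ℂ) (fun x y z => xyzToCw a x * xyzToCw b y * xyzToCw c z)]
  fin_cases a <;> fin_cases b <;> fin_cases c <;>
    simp [xyzToCw, cwTensor_apply, Complex.ext_iff] <;> norm_num

/-- Hence `bR(T_{cw,2}^{⊠N}) ≤ bR(X^{⊠N})` for every `N`. [cite: ConnerGesmundoLandsbergVentura2022, §1.1] -/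
theorem algBorderRank_kroneckerPow_cw_le_xyz (N : ℕ) :
    algBorderRank (kroneckerPow (cwTensor ℂ 2) N) ≤ algBorderRank (kroneckerPow (xyzTensor ℂ) N) :=
  (tensorRestrictsTo_xyzTensor_cwTensor.kroneckerPow N).algBorderRank_le

end XyzToCw

/-! ## Digit designs -/

section Design

variable {B : Type*} [AddCommGroup B] {N : ℕ}

/-- The word sum `P(u) = ∑ₖ f k (u k)` of a digit system `f`. [cite: AlmanVassilevskaWilliams2018, Thm. 7.2] -/
def wordSum (f : Fin N → Fin 3 → B) (u : Fin N → Fin 3) : B := ∑ k, f k (u k)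

/-- The word weight `wt(u) = ∑ₖ a k (u k)` of a digit-weight system `a`. [cite: AlmanVassilevskaWilliams2018, Thm. 7.2] -/
def wordWt (a : Fin N → Fin 3 → ℕ) (u : Fin N → Fin 3) : ℕ := ∑ k, a k (u k)

/-- On a permutation of `(0,1,2)` any function sums to `g 0 + g 1 + g 2`. [folklore] -/
theorem sum_three_of_distinct {M : Type*} [AddCommMonoid M] (g : Fin 3 → M) {x y z : Fin 3}
    (hxy : x ≠ y) (hxz : x ≠ z) (hyz : y ≠ z) : g x + g y + g z = g 0 + g 1 + g 2 := by
  have hx : x ∉ ({y, z} : Finset (Fin 3)) := by simp [hxy, hxz]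
  have hy : y ∉ ({z} : Finset (Fin 3)) := by simp [hyz]
  have huniv : ({x, y, z} : Finset (Fin 3)) = Finset.univ :=
    Finset.eq_univ_of_card _ (by
      rw [Finset.card_insert_of_notMem hx, Finset.card_insert_of_notMem hy,
        Finset.card_singleton, Fintype.card_fin])
  have hsum := Finset.sum_insert hx (f := g)
  rw [Finset.sum_insert hy, Finset.sum_singleton, huniv, Fin.sum_univ_three] at hsum
  rw [hsum, add_assoc]

/-- On `S_N` the three word sums add up to `σ = ∑ₖ (f k 0 + f k 1 + f k 2)`. [folklore] -/
theorem wordSum_add_of_distinct {M : Type*} [AddCommMonoid M] (f : Fin N → Fin 3 → M)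
    {u v w : Fin N → Fin 3} (h : ∀ k, u k ≠ v k ∧ u k ≠ w k ∧ v k ≠ w k) :
    ∑ k, f k (u k) + ∑ k, f k (v k) + ∑ k, f k (w k) = ∑ k, (f k 0 + f k 1 + f k 2) := by
  rw [← Finset.sum_add_distrib, ← Finset.sum_add_distrib]
  exact Finset.sum_congr rfl fun k _ => sum_three_of_distinct (f k) (h k).1 (h k).2.1 (h k).2.2

/-- Entries of `X^{⊠N}`: `1` on `S_N` (coordinatewise pairwise distinct), `0` elsewhere. [folklore] -/
theorem kroneckerPow_xyzTensor_apply {R : Type*} [CommSemiring R] (u v w : Fin N → Fin 3) :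
    kroneckerPow (xyzTensor R) N u v w =
      if ∀ k, u k ≠ v k ∧ u k ≠ w k ∧ v k ≠ w k then 1 else 0 := by
  rw [kroneckerPow_apply]
  simp_rw [xyzTensor_apply, comp1_eq_some_iff]
  rw [Finset.prod_boole]
  simp

variable [Fintype B] [DecidableEq B]

/-- **Exact digit designs bound the RANK.** If `P u + P v + P w = σ` holds ONLY on `S_N`, then
`X^{⊠N}(u,v,w) = |B|⁻¹ ∑_ψ ψ(P u) ψ(P v) ψ(P w − σ)` is a restriction of the structure tensor of `ℂ[B]`
along `P`, so `R(X^{⊠N}) ≤ |B|` — exact designs sit below rank (not just border-rank)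
multiplicativity of `X`. [cite: CohnKleinbergSzegedyUmans2005, Thm. 5.5] -/
theorem tensorRank_kroneckerPow_xyzTensor_le_card (f : Fin N → Fin 3 → B)
    (hex : ∀ u v w : Fin N → Fin 3,
      wordSum f u + wordSum f v + wordSum f w = ∑ k, (f k 0 + f k 1 + f k 2) →
        ∀ k, u k ≠ v k ∧ u k ≠ w k ∧ v k ≠ w k) :
    tensorRank (kroneckerPow (xyzTensor ℂ) N) ≤ Fintype.card B := by
  classical
  set σ := ∑ k, (f k 0 + f k 1 + f k 2) with hσ
  have hcard : (Fintype.card B : ℂ) ≠ 0 := Nat.cast_ne_zero.2 Fintype.card_ne_zero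
  rw [← AddChar.card_eq (α := B)]
  refine tensorRank_le_card_of_eq_sum (fun ψ x => ψ (wordSum f x)) (fun ψ y => ψ (wordSum f y))
    (fun ψ z => ψ (wordSum f z - σ) / (Fintype.card B : ℂ)) ?_
  funext x y z
  rw [Finset.sum_apply, Finset.sum_apply, Finset.sum_apply]
  simp only [triad_apply]
  have key : ∀ ψ : AddChar B ℂ, ψ (wordSum f x) * ψ (wordSum f y) *
      (ψ (wordSum f z - σ) / (Fintype.card B : ℂ)) =
      ψ (wordSum f x + wordSum f y + (wordSum f z - σ)) / (Fintype.card B : ℂ) := by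
    intro ψ
    rw [AddChar.map_add_eq_mul, AddChar.map_add_eq_mul]
    ring
  simp_rw [key]
  rw [← Finset.sum_div, AddChar.sum_apply_eq_ite, kroneckerPow_xyzTensor_apply]
  have hiff : wordSum f x + wordSum f y + (wordSum f z - σ) = 0 ↔
      wordSum f x + wordSum f y + wordSum f z = σ := by
    rw [← add_sub_assoc, sub_eq_zero]
  by_cases hS : ∀ k, x k ≠ y k ∧ x k ≠ z k ∧ y k ≠ z k
  · rw [if_pos hS, if_pos (hiff.2 (wordSum_add_of_distinct f hS)), div_self hcard]
  · rw [if_neg hS, if_neg (fun h => hS (hex x y z (hiff.1 h))), zero_div]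

/-- Hence `R(T_{cw,2}^{⊠N}) ≤ |B|` for every EXACT digit design of `S_N` in `B` (restriction
`X ≥ T_{cw,2}`, `TensorRestrictsTo.tensorRank_le`). [cite: CohnKleinbergSzegedyUmans2005, Thm. 5.5] -/
theorem tensorRank_kroneckerPow_cwTensor_two_le_card (f : Fin N → Fin 3 → B)
    (hex : ∀ u v w : Fin N → Fin 3,
      wordSum f u + wordSum f v + wordSum f w = ∑ k, (f k 0 + f k 1 + f k 2) →
        ∀ k, u k ≠ v k ∧ u k ≠ w k ∧ v k ≠ w k) :
    tensorRank (kroneckerPow (cwTensor ℂ 2) N) ≤ Fintype.card B :=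
  ((tensorRestrictsTo_xyzTensor_cwTensor.kroneckerPow N).tensorRank_le).trans
    (tensorRank_kroneckerPow_xyzTensor_le_card f hex)

/-- **Weighted digit designs give approximate decompositions.** If every solution of
`P(u) + P(v) + P(w) = σ` off `S_N` has total weight `> h₀ = ∑ₖ (a k 0 + a k 1 + a k 2)`, then
`R_{h₀}(X^{⊠N}) ≤ |B|`: the `|B̂| = |B|` triads `u_ψ(u) = ψ(P u) ε^{wt u}`, `v_ψ(v) = ψ(P v) ε^{wt v}`,
`w_ψ(w) = |B|⁻¹ ψ(P w − σ) ε^{wt w}` sum to `[P u + P v + P w = σ] ε^{wt u + wt v + wt w}`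
(orthogonality of characters), which is `ε^{h₀}` on `S_N`, `0` or `O(ε^{h₀+1})` off it.
[cite: AlmanVassilevskaWilliams2018, Thm. 7.2] -/
theorem approxRank_kroneckerPow_xyzTensor_le_card (f : Fin N → Fin 3 → B) (a : Fin N → Fin 3 → ℕ)
    (hdes : ∀ u v w : Fin N → Fin 3,
      wordSum f u + wordSum f v + wordSum f w = ∑ k, (f k 0 + f k 1 + f k 2) →
        (∀ k, u k ≠ v k ∧ u k ≠ w k ∧ v k ≠ w k) ∨
          ∑ k, (a k 0 + a k 1 + a k 2) < wordWt a u + wordWt a v + wordWt a w) :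
    approxRank (∑ k, (a k 0 + a k 1 + a k 2)) (kroneckerPow (xyzTensor ℂ) N) ≤ Fintype.card B := by
  classical
  set h0 := ∑ k, (a k 0 + a k 1 + a k 2) with hh0
  set σ := ∑ k, (f k 0 + f k 1 + f k 2) with hσ
  have hcard : (Fintype.card B : ℂ) ≠ 0 := Nat.cast_ne_zero.2 Fintype.card_ne_zero
  rw [← AddChar.card_eq (α := B)]
  set r := Fintype.card (AddChar B ℂ)
  let e : Fin r ≃ AddChar B ℂ := (Fintype.equivFin (AddChar B ℂ)).symm
  refine approxRank_le_of_isApproxDecomposition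
    (u := fun ρ x => C ((e ρ) (wordSum f x)) * X ^ wordWt a x)
    (v := fun ρ y => C ((e ρ) (wordSum f y)) * X ^ wordWt a y)
    (w := fun ρ z => C ((e ρ) (wordSum f z - σ) * (Fintype.card B : ℂ)⁻¹) * X ^ wordWt a z) ?_
  intro x y z j hj
  -- each triad contributes `C(ψ(P x + P y + P z − σ)/|B|) ε^{n}`
  have hterm : ∀ ψ : AddChar B ℂ,
      C (ψ (wordSum f x)) * X ^ wordWt a x * (C (ψ (wordSum f y)) * X ^ wordWt a y) *
        (C (ψ (wordSum f z - σ) * (Fintype.card B : ℂ)⁻¹) * X ^ wordWt a z) =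
      C (ψ (wordSum f x + wordSum f y + wordSum f z - σ) * (Fintype.card B : ℂ)⁻¹) *
        X ^ (wordWt a x + wordWt a y + wordWt a z) := by
    intro ψ
    rw [show wordSum f x + wordSum f y + wordSum f z - σ =
        wordSum f x + wordSum f y + (wordSum f z - σ) by abel,
      AddChar.map_add_eq_mul, AddChar.map_add_eq_mul]
    simp only [map_mul, pow_add]
    ring
  have hsum : ∑ ρ : Fin r, C ((e ρ) (wordSum f x)) * X ^ wordWt a x *
        (C ((e ρ) (wordSum f y)) * X ^ wordWt a y) *
        (C ((e ρ) (wordSum f z - σ) * (Fintype.card B : ℂ)⁻¹) * X ^ wordWt a z) =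
      C (if wordSum f x + wordSum f y + wordSum f z = σ then (1 : ℂ) else 0) *
        X ^ (wordWt a x + wordWt a y + wordWt a z) := by
    simp_rw [hterm]
    rw [← Finset.sum_mul, ← map_sum,
      e.sum_comp (fun ψ : AddChar B ℂ =>
        ψ (wordSum f x + wordSum f y + wordSum f z - σ) * (Fintype.card B : ℂ)⁻¹),
      ← Finset.sum_mul, AddChar.sum_apply_eq_ite]
    congr 2
    by_cases hS : wordSum f x + wordSum f y + wordSum f z = σ
    · rw [if_pos (sub_eq_zero.2 hS), if_pos hS, mul_inv_cancel₀ hcard]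
    · rw [if_neg (fun h => hS (sub_eq_zero.1 h)), if_neg hS, zero_mul]
  simp only [hsum, Polynomial.coeff_C_mul_X_pow, kroneckerPow_xyzTensor_apply]
  by_cases hgrp : wordSum f x + wordSum f y + wordSum f z = σ
  · rw [if_pos hgrp]
    rcases hdes x y z hgrp with hS | hlt
    · -- on `S_N`: weight exactly `h0`
      have hwt : wordWt a x + wordWt a y + wordWt a z = h0 := wordSum_add_of_distinct a hS
      rw [hwt, if_pos hS]
    · -- off `S_N`: weight `> h0 ≥ j`
      have hne : j ≠ wordWt a x + wordWt a y + wordWt a z := by omega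
      have hnotS : ¬ ∀ k, x k ≠ y k ∧ x k ≠ z k ∧ y k ≠ z k := by
        intro hS
        have hwt : wordWt a x + wordWt a y + wordWt a z = h0 := wordSum_add_of_distinct a hS
        omega
      rw [if_neg hne, if_neg hnotS, ite_self]
  · rw [if_neg hgrp, ite_self]
    have hnotS : ¬ ∀ k, x k ≠ y k ∧ x k ≠ z k ∧ y k ≠ z k :=
      fun hS => hgrp (wordSum_add_of_distinct f hS)
    rw [if_neg hnotS, ite_self]

/-- `bR(X^{⊠N}) ≤ |B|` for every weighted digit design of `S_N` in `B`. [cite: AlmanVassilevskaWilliams2018, Thm. 7.2] -/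
theorem algBorderRank_kroneckerPow_xyzTensor_le_card (f : Fin N → Fin 3 → B) (a : Fin N → Fin 3 → ℕ)
    (hdes : ∀ u v w : Fin N → Fin 3,
      wordSum f u + wordSum f v + wordSum f w = ∑ k, (f k 0 + f k 1 + f k 2) →
        (∀ k, u k ≠ v k ∧ u k ≠ w k ∧ v k ≠ w k) ∨
          ∑ k, (a k 0 + a k 1 + a k 2) < wordWt a u + wordWt a v + wordWt a w) :
    algBorderRank (kroneckerPow (xyzTensor ℂ) N) ≤ Fintype.card B :=
  (algBorderRank_le_approxRank _ _).trans (approxRank_kroneckerPow_xyzTensor_le_card f a hdes)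

/-- **`bR(T_{cw,2}^{⊠N}) ≤ |B|`** for every weighted digit design of `S_N` in a finite abelian group
`B` — the finite certificate door D6 opens on. [cite: AlmanVassilevskaWilliams2018, Thm. 7.2] -/
theorem algBorderRank_kroneckerPow_cwTensor_two_le_card (f : Fin N → Fin 3 → B)
    (a : Fin N → Fin 3 → ℕ)
    (hdes : ∀ u v w : Fin N → Fin 3,
      wordSum f u + wordSum f v + wordSum f w = ∑ k, (f k 0 + f k 1 + f k 2) →
        (∀ k, u k ≠ v k ∧ u k ≠ w k ∧ v k ≠ w k) ∨
          ∑ k, (a k 0 + a k 1 + a k 2) < wordWt a u + wordWt a v + wordWt a w) :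
    algBorderRank (kroneckerPow (cwTensor ℂ 2) N) ≤ Fintype.card B :=
  (algBorderRank_kroneckerPow_cw_le_xyz N).trans (algBorderRank_kroneckerPow_xyzTensor_le_card f a hdes)

/-- **`R̃(T_{cw,2}) ≤ |B|^{1/N}`** from one weighted digit design of `S_N` (`N ≥ 1`).
[cite: AlmanVassilevskaWilliams2018, Thm. 7.2] -/
theorem asymptoticRank_cwTensor_two_le_of_design (hN : 0 < N) (f : Fin N → Fin 3 → B)
    (a : Fin N → Fin 3 → ℕ)
    (hdes : ∀ u v w : Fin N → Fin 3,
      wordSum f u + wordSum f v + wordSum f w = ∑ k, (f k 0 + f k 1 + f k 2) →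
        (∀ k, u k ≠ v k ∧ u k ≠ w k ∧ v k ≠ w k) ∨
          ∑ k, (a k 0 + a k 1 + a k 2) < wordWt a u + wordWt a v + wordWt a w) :
    asymptoticRank (cwTensor ℂ 2) ≤ (Fintype.card B : ℝ) ^ ((N : ℝ)⁻¹) :=
  asymptoticRank_le_rpow_of_algBorderRank_kroneckerPow_le hN
    (algBorderRank_kroneckerPow_cwTensor_two_le_card f a hdes)

/-- **Quantitative form**: a weighted digit design of `S_N` in `B` with `|B|^{1/N} < ρ` gives
`ω(ℂ) ≤ log₂(4ρ³/27)` (the tree's CW analysis of `T_{cw,2}` fed with `R̃(T_{cw,2}) < ρ`); e.g.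
`|B| < 3.268^N` would give `ω < 2.3716`. [cite: AlmanVassilevskaWilliams2018, Thm. 7.2] -/
theorem omega_le_of_design (hN : 0 < N) (f : Fin N → Fin 3 → B) (a : Fin N → Fin 3 → ℕ)
    (hdes : ∀ u v w : Fin N → Fin 3,
      wordSum f u + wordSum f v + wordSum f w = ∑ k, (f k 0 + f k 1 + f k 2) →
        (∀ k, u k ≠ v k ∧ u k ≠ w k ∧ v k ≠ w k) ∨
          ∑ k, (a k 0 + a k 1 + a k 2) < wordWt a u + wordWt a v + wordWt a w)
    {ρ : ℝ} (hρ : (Fintype.card B : ℝ) ^ ((N : ℝ)⁻¹) < ρ) :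
    omega ℂ ≤ Real.logb (2 : ℕ) (4 * ρ ^ 3 / 27) :=
  omega_le_logb_of_asymptoticRank_cwTensor_lt (le_refl 2)
    ((asymptoticRank_cwTensor_two_le_of_design hN f a hdes).trans_lt hρ)

end Design

/-! ## The base case `N = 1`: the Alman–Vassilevska Williams design in `ℤ/4` -/

section BaseCase

/-- The AVW digits `(0,1,2)` in `ℤ/4` (`CW_2 ⊴ T_{ℤ/4}`). [cite: AlmanVassilevskaWilliams2018, Thm. 7.2] -/
def avwDigits : Fin 1 → Fin 3 → ZMod 4 := fun _ => ![0, 1, 2]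

/-- The AVW weights `(0,1,0)` (twice the exponents `(0,½,0)`). [cite: AlmanVassilevskaWilliams2018, Thm. 7.2] -/
def avwWeights : Fin 1 → Fin 3 → ℕ := fun _ => ![0, 1, 0]

/-- **The design hypothesis is inhabited**: `(0,1,2)`/`(0,1,0)` in `ℤ/4` is a weighted digit design of
`S_1` — the only off-`S_1` solution of `f u + f v + f w = 3 (mod 4)` is `(1,1,1)`, of weight `3 > 1 = h₀`.
[cite: AlmanVassilevskaWilliams2018, Thm. 7.2] -/
theorem avw_design : ∀ u v w : Fin 1 → Fin 3,
    wordSum avwDigits u + wordSum avwDigits v + wordSum avwDigits w =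
        ∑ k, (avwDigits k 0 + avwDigits k 1 + avwDigits k 2) →
      (∀ k, u k ≠ v k ∧ u k ≠ w k ∧ v k ≠ w k) ∨
        ∑ k, (avwWeights k 0 + avwWeights k 1 + avwWeights k 2) <
          wordWt avwWeights u + wordWt avwWeights v + wordWt avwWeights w := by
  intro u v w
  simp only [wordSum, wordWt, avwDigits, avwWeights, Fin.sum_univ_one, Fin.forall_fin_one]
  generalize u 0 = x
  generalize v 0 = y
  generalize w 0 = z
  revert x y z
  decide

/-- The door's hypothesis is inhabited at `ε = 1`: the AVW design lives in a group of order
`4 = (3+1)^1` — `matrixMultiplication_of_weighted_designs` below asks for the same at every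
smaller `ε`. [cite: AlmanVassilevskaWilliams2018, Thm. 7.2] -/
theorem exists_weighted_design_at_one :
    ∃ (N : ℕ) (B : Type) (_ : AddCommGroup B) (_ : Fintype B) (_ : DecidableEq B)
      (f : Fin N → Fin 3 → B) (a : Fin N → Fin 3 → ℕ), 0 < N ∧
      (∀ u v w : Fin N → Fin 3,
        wordSum f u + wordSum f v + wordSum f w = ∑ k, (f k 0 + f k 1 + f k 2) →
          (∀ k, u k ≠ v k ∧ u k ≠ w k ∧ v k ≠ w k) ∨
            ∑ k, (a k 0 + a k 1 + a k 2) < wordWt a u + wordWt a v + wordWt a w) ∧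
      (Fintype.card B : ℝ) ≤ (3 + 1) ^ N :=
  ⟨1, ZMod 4, inferInstance, inferInstance, inferInstance, avwDigits, avwWeights, Nat.one_pos,
    avw_design, by norm_num [ZMod.card]⟩

end BaseCase

/-! ## The door -/

/-- **DOOR D6 (kernel form).** If for every `ε > 0` some `S_N` (`N ≥ 1`) has a weighted digit design
in a finite abelian group of order `≤ (3+ε)^N`, then `R̃(T_{cw,2}) ≤ 3` and hence `ω(ℂ) = 2`
(`matrixMultiplication_of_asymptoticRank_cwTensor_two_le_three`, door D1). [cite: AlmanVassilevskaWilliams2018, Thm. 7.2 and Rem. 6.1] -/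
theorem matrixMultiplication_of_weighted_designs
    (h : ∀ ε : ℝ, 0 < ε → ∃ (N : ℕ) (B : Type) (_ : AddCommGroup B) (_ : Fintype B)
      (_ : DecidableEq B) (f : Fin N → Fin 3 → B) (a : Fin N → Fin 3 → ℕ), 0 < N ∧
      (∀ u v w : Fin N → Fin 3,
        wordSum f u + wordSum f v + wordSum f w = ∑ k, (f k 0 + f k 1 + f k 2) →
          (∀ k, u k ≠ v k ∧ u k ≠ w k ∧ v k ≠ w k) ∨
            ∑ k, (a k 0 + a k 1 + a k 2) < wordWt a u + wordWt a v + wordWt a w) ∧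
      (Fintype.card B : ℝ) ≤ (3 + ε) ^ N) :
    _root_.MatrixMultiplication := by
  refine matrixMultiplication_of_asymptoticRank_cwTensor_two_le_three
    (le_of_forall_pos_le_add fun ε hε => ?_)
  obtain ⟨N, B, _, _, _, f, a, hN, hdes, hcard⟩ := h ε hε
  have h1 := asymptoticRank_cwTensor_two_le_of_design hN f a hdes
  have h3 : (0 : ℝ) ≤ 3 + ε := by linarith
  calc asymptoticRank (cwTensor ℂ 2) ≤ (Fintype.card B : ℝ) ^ ((N : ℝ)⁻¹) := h1
    _ ≤ ((3 + ε) ^ N) ^ ((N : ℝ)⁻¹) :=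
        Real.rpow_le_rpow (Nat.cast_nonneg _) hcard (by positivity)
    _ = 3 + ε := Real.pow_rpow_inv_natCast h3 hN.ne'

end Summit.MatrixMultiplication.MatrixMultiplication.Theorems

end
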